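import Mathlib
import Literature.RingTheory.KrullDimension.AffineDimension
import Literature.AlgebraicGeometry.Resolution.AdicNoetherian
import Literature.RingTheory.HilbertSamuel.MinimalPrimesCodim
import HarnessLib

/-!
# Route `PicardMuOrdinary`, crux `MuOrdinaryFamilyRT` (stmt-Langlands-13757): stub 3 of the line
# `free-seed-smooth-rt` — the Krull squeeze

This file proves STUB 3 (`stub_squeeze`, the Krull-dimension squeeze, Mazur's smooth-deformation-ring
lever run `Λ`-adically) of the checked skeleton
`Cruxes/MuOrdinaryFamilyRT/Lines/free-seed-smooth-rt.lean` for the crux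
`Summit.Langlands.Langlands.Theses.PicardMuOrdinary.MuOrdinaryFamilyRT` (item `stmt-Langlands-13757`).
The statement `S.stub_squeeze` below is VERBATIM the registered statement of the skeleton (declared in
the skeleton's namespace `Summit.Langlands.Langlands.Cruxes.MuOrdinaryFamilyRT.FreeSeedSmoothRt`, so
that the landed stub reads byte-identically to its registration); it is pure commutative algebra.

**Statement.** `𝒪` a discrete valuation ring, `P = 𝒪⟦X,Y,Z⟧ = MvPowerSeries (Fin 3) 𝒪`,
`s : P ↠ R` and `φ : R ↠ T` surjective `𝒪`-algebra maps, `Λ : P → T` a finite injective `𝒪`-algebra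
map.  Then `s` and `φ` are bijective.

**Proof.** `P` is a Noetherian (tree: `isNoetherianRing_mvPowerSeries`, Stacks 0306) local domain,
hence of finite Krull dimension (Krull's height theorem, Mathlib's `FiniteRingKrullDim` instance for
Noetherian local rings).  `T` is a finite, hence integral, injective extension of `P` through `Λ`, so
`dim T = dim P` (tree: `ringKrullDim_eq_of_isIntegral`, going-up + incomparability).  The composite
`ψ := φ ∘ s : P ↠ T` is surjective, so `T ≃ P ⧸ ker ψ`; if `ker ψ ≠ ⊥` then
`dim T + 1 = dim (P ⧸ ker ψ) + 1 ≤ dim P` (tree: `ringKrullDim_quotient_add_one_le`: a proper quotient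
of a domain drops dimension), contradicting `dim T = dim P ∈ ℕ` (tree:
`Literature.RingTheory.HilbertSamuel.exists_nat_eq_of_ne_bot_of_ne_top`).  Hence `ψ` is injective,
so `s` is injective (hence bijective) and then `φ` is injective (hence bijective).  Only finiteness
of `dim P` is used, not its value `4`.

References: Matsumura, *Commutative Ring Theory*, Thm 9.4 (going up), Thm 13.5 (Krull);
Mazur, *Deforming Galois representations* (1989), §1.6–1.7 (the smoothness squeeze).
-/

-- `Summit.Langlands.Langlands.…` (summit = sub-problem name, D-0017 layout) trips `dupNamespace` on every decl.
set_option linter.dupNamespace false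

namespace Summit.Langlands.Langlands.Cruxes.MuOrdinaryFamilyRT.FreeSeedSmoothRt

/-! ## The registered statement (verbatim) -/

/-- STUB 3 (THE KRULL SQUEEZE — the lever; pure commutative algebra, provable now).  `𝒪` a discrete
valuation ring, `P = 𝒪⟦X,Y,Z⟧` (`MvPowerSeries (Fin 3) 𝒪`: a Noetherian domain of Krull dimension 4),
`s : P ↠ R`, `φ : R ↠ T` surjective `𝒪`-algebra maps and `Λ : P → T` finite injective (so `T ≠ 0` and
`dim T = dim P`): then `φ ∘ s : P ↠ T` is a surjection from a finite-dimensional Noetherian domain onto a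
ring of the same dimension, hence injective (a proper quotient of such a domain drops dimension), so
`s` and `φ` are both bijective.  The card's First lemma `injective_of_surjective_of_ringKrullDim_eq` +
`dim 𝒪⟦X,Y,Z⟧ = 4` (Krull's height theorem) + `dim` invariance under finite injective extensions.
Size M.  Leans on: Mathlib `ringKrullDim`, `MvPowerSeries.instNoZeroDivisors`, `Ideal.height`. -/
def S.stub_squeeze : Prop :=
  ∀ (𝒪 : Type) [CommRing 𝒪] [IsDomain 𝒪] [IsDiscreteValuationRing 𝒪]
    (R T : Type) [CommRing R] [CommRing T] [Algebra 𝒪 R] [Algebra 𝒪 T]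
    (s : MvPowerSeries (Fin 3) 𝒪 →ₐ[𝒪] R) (φ : R →ₐ[𝒪] T) (Λ : MvPowerSeries (Fin 3) 𝒪 →ₐ[𝒪] T),
    Function.Surjective s → Function.Surjective φ → Function.Injective Λ → Λ.toRingHom.Finite →
    Function.Bijective s ∧ Function.Bijective φ

/-! ## The dimension squeeze -/

/-- **The Krull squeeze** (abstract form).  Let `P` be a domain of finite Krull dimension, `ψ : P ↠ T`
a surjective ring map and `Λ : P → T` a finite injective ring map.  Then `ψ` is injective: `T` is an
integral injective extension of `P`, so `dim T = dim P`, while a proper quotient of the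
finite-dimensional domain `P` has strictly smaller dimension. -/
theorem injective_of_surjective_of_finite_injective {P T : Type*} [CommRing P] [IsDomain P]
    [FiniteRingKrullDim P] [CommRing T] (ψ : P →+* T) (hψ : Function.Surjective ψ) (Λ : P →+* T)
    (hΛ : Function.Injective Λ) (hfin : Λ.Finite) : Function.Injective ψ := by
  -- `dim P = dim T`: `T` is integral over (the isomorphic copy `Λ P` of) `P`.
  have hdim : ringKrullDim P = ringKrullDim T := by
    letI : Algebra P T := Λ.toAlgebra
    haveI : Module.Finite P T := hfin
    exact Literature.RingTheory.KrullDimension.ringKrullDim_eq_of_isIntegral (R := P) (S := T) hΛ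
  rw [RingHom.injective_iff_ker_eq_bot]
  by_contra hker
  -- a proper quotient of the domain `P` drops the dimension ...
  have h1 := Literature.RingTheory.KrullDimension.ringKrullDim_quotient_add_one_le hker
  -- ... but `P ⧸ ker ψ ≃ T` has the dimension of `P`.
  have h2 : ringKrullDim (P ⧸ RingHom.ker ψ) = ringKrullDim T :=
    ringKrullDim_eq_of_ringEquiv (RingHom.quotientKerEquivOfSurjective hψ)
  rw [h2, ← hdim] at h1
  -- `dim P ∈ ℕ` (neither `⊥` nor `⊤`), and `m + 1 ≤ m` is absurd
  obtain ⟨m, hm⟩ := Literature.RingTheory.HilbertSamuel.exists_nat_eq_of_ne_bot_of_ne_top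
    (ringKrullDim_ne_bot (R := P)) (ringKrullDim_ne_top (R := P))
  rw [hm] at h1
  exact lt_irrefl _ (ENat.WithBot.add_one_le_iff.1 h1)

/-! ## The registered stub -/

/-- **STUB 3 of the line `free-seed-smooth-rt` (`stub_squeeze`, registered signature verbatim): the
Krull squeeze.**  For a discrete valuation ring `𝒪`, surjective `𝒪`-algebra maps
`s : 𝒪⟦X,Y,Z⟧ ↠ R`, `φ : R ↠ T` and a finite injective `Λ : 𝒪⟦X,Y,Z⟧ → T`, both `s` and `φ` are
bijective.  `𝒪⟦X,Y,Z⟧ = MvPowerSeries (Fin 3) 𝒪` is a Noetherian local domain, hence of finite Krull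
dimension, and `injective_of_surjective_of_finite_injective` applies to `ψ = φ ∘ s`. -/
theorem stub_squeeze : S.stub_squeeze := by
  intro 𝒪 _ _ _ R T _ _ _ _ s φ Λ hs hφ hΛ hfin
  haveI : IsNoetherianRing (MvPowerSeries (Fin 3) 𝒪) :=
    Literature.AlgebraicGeometry.Resolution.isNoetherianRing_mvPowerSeries 𝒪 (Fin 3)
  haveI : IsDomain (MvPowerSeries (Fin 3) 𝒪) := NoZeroDivisors.to_isDomain _
  -- the composite `ψ = φ ∘ s : 𝒪⟦X,Y,Z⟧ ↠ T` is injective by the squeeze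
  have hψ : Function.Injective (φ.toRingHom.comp s.toRingHom) :=
    injective_of_surjective_of_finite_injective (φ.toRingHom.comp s.toRingHom) (hφ.comp hs)
      Λ.toRingHom hΛ hfin
  have hψ' : Function.Injective (φ ∘ s) := hψ
  have hs_inj : Function.Injective s := hψ'.of_comp
  refine ⟨⟨hs_inj, hs⟩, ?_, hφ⟩
  intro r₁ r₂ h
  obtain ⟨p₁, rfl⟩ := hs r₁
  obtain ⟨p₂, rfl⟩ := hs r₂
  exact congrArg s (hψ' h)

end Summit.Langlands.Langlands.Cruxes.MuOrdinaryFamilyRT.FreeSeedSmoothRt
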